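import Mathlib
import Summits.NavierStokesRegularity.NavierStokesRegularity.Theorems.SubOnsagerCeilingSideBranchLiveGain
import HarnessLib

/-!
# Route SubOnsagerCeiling — the THRESHOLD STEP of the cascade of `α_SB`
# (helper file for item stmt-NavierStokesRegularity-25507 `OrthantTailCeiling`; `--supports`; def-free)

Fourth brick of the ENGINE for the Onsager-critical escape construction (`SideBranchCriticalEscapeEstimateAt`,
p823602): the cascade step with the drains controlled by the ESCAPED ENERGY itself, so that the
Katz–Pavlović-type induction over shells needs no analysis any more.  Notation (inline):
`B_k(u) = Σ_{j ≤ k} Σ_i ½X_{i,j}(u)²`, `E₀ = Σ_i ½X₀_i²`, escaped energy past the chain mode `x_k`: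
`A_k(u) = E₀ − B_k(u) + ½ s_k(u)²`.  Along a regular NON-NEGATIVE solution of the `ν`-viscous `α_SB`
lattice on `[0,s]` from the one-shell datum `X₀`:

* `sideBranch_block_antitone` — blocks only lose energy: `B_J(u₂) ≤ B_J(u₁)` for `u₁ ≤ u₂`
  (`B_J' = −Π_J − D_J ≤ 0`, bond flux `Π_J ≥ 0` by non-negativity);
* `sideBranch_mode_sq_le_escaped` — every mode one or two shells beyond the block is paid for by the
  escaped energy: `½X_{i,k+1}(u)², ½X_{i,k+2}(u)² ≤ A_k(u)`;
* `sideBranch_threshold_step` — if on `[t₀,t₁] ⊆ [0,s]` the driver is on, `Λ_k x_k² ≥ a ≥ 0`, and the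
  escaped energy has NOT yet reached the threshold, `A_k ≤ θ` on `[t₀,t₁]`, then nevertheless
  `A_k(t₁) ≥ A_k(t₀) + a·(a/r)·((t₁ − t₀) − 1/r)` with `r = (6/5)Λ_{k+1}√(2θ) + ν_{k+1}`
  (`sideBranch_liveBlock_gain` with `ρ = √(2θ)`).  Choosing `t₁ − t₀ ≥ 1/r + θ·r/a²` contradicts
  `A_k(t₁) ≤ θ` — this is the whole content of one induction step, the driver level `a` being supplied
  by the previous step and the (open) SPLIT estimate on the side unit `(s_{k-1}, z_k)`.

HONEST FRAMING: elementary real analysis of a Tao-type MODEL lattice ODE (route SubOnsagerCeiling, rung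
TL-M2Break); a brick toward a construction NOT carried out here; nothing bears on Navier–Stokes
regularity; no crux is settled here. [cite: Tao2016AveragedNS, §4 (4.2)–(4.3), (4.5)]
-/

noncomputable section

-- the sub-problem namespace `NavierStokesRegularity.NavierStokesRegularity` is the tree's layout (D-0017)
set_option linter.dupNamespace false

namespace Summit.NavierStokesRegularity.NavierStokesRegularity.Theorems.SubOnsagerCeiling

open Set
open Literature.Analysis.FluidPDE.TaoCascade

section Solution

variable {ε₀ ν s : ℝ} {X₀ : Fin 4 → ℝ} {X : Fin 4 → ℤ → ℝ → ℝ}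

/-- **Blocks only lose energy.** Along a regular solution of the `ν`-viscous `α_SB` lattice on `[0,s]`
(`ν ≥ 0`, no shells below `0`) that is non-negative on the shells `≥ 0`, every block energy
`B_J(u) = Σ_{j ≤ J} Σ_i ½X_{i,j}(u)²` is non-increasing on `[0,s]` (`B_J' = −Π_J − D_J`, `Π_J ≥ 0`).
[this file] -/
theorem sideBranch_block_antitone (hε : 0 < ε₀) (hν : 0 ≤ ν)
    (hlow : ∀ (i : Fin 4) (k : ℤ), k < 0 → ∀ t : ℝ, X i k t = 0)
    (hder : ∀ (i : Fin 4) (k : ℤ), ∀ t ∈ Icc (0 : ℝ) s, HasDerivWithinAt (X i k)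
      (quadTerm ε₀ sideBranchTable X i k t - ν * (1 + ε₀) ^ ((2 : ℝ) * k) * X i k t)
      (Icc (0 : ℝ) s) t)
    (hpos : ∀ t ∈ Icc (0 : ℝ) s, ∀ (i : Fin 4) (k : ℤ), 0 ≤ k → 0 ≤ X i k t)
    (J : ℕ) {u₁ u₂ : ℝ} (hu₁ : 0 ≤ u₁) (hu : u₁ ≤ u₂) (hu₂ : u₂ ≤ s) :
    (∑ j ∈ Finset.range (J + 1), ∑ i : Fin 4, (1 / 2 : ℝ) * X i (j : ℤ) u₂ ^ 2) ≤
      ∑ j ∈ Finset.range (J + 1), ∑ i : Fin 4, (1 / 2 : ℝ) * X i (j : ℤ) u₁ ^ 2 := by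
  have hb : (0 : ℝ) < 1 + ε₀ := by linarith
  have hsub : Icc u₁ u₂ ⊆ Icc (0 : ℝ) s := Icc_subset_Icc hu₁ hu₂
  -- `−B_J` is non-decreasing: derivative `Π_J + D_J ≥ 0`
  set Φ : ℝ → ℝ := fun w => -(∑ j ∈ Finset.range (J + 1), ∑ i : Fin 4,
    (1 / 2 : ℝ) * X i (j : ℤ) w ^ 2) with hΦ
  have hderΦ : ∀ w ∈ Icc u₁ u₂, HasDerivWithinAt Φ
      (botSum ε₀ sideBranchTable X (J : ℤ) w +
        ∑ j ∈ Finset.range (J + 1), ∑ i : Fin 4,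
          ν * (1 + ε₀) ^ ((2 : ℝ) * ((j : ℤ) : ℝ)) * X i (j : ℤ) w ^ 2) (Icc u₁ u₂) w := by
    intro w hw
    have h1 := sideBranch_liveBlock_hasDerivWithinAt hlow hder J (hsub hw)
    have h2 : HasDerivWithinAt (fun w => (1 / 2 : ℝ) * X 1 (J : ℤ) w ^ 2)
        (X 1 (J : ℤ) w * (quadTerm ε₀ sideBranchTable X 1 (J : ℤ) w -
          ν * (1 + ε₀) ^ ((2 : ℝ) * ((J : ℤ) : ℝ)) * X 1 (J : ℤ) w)) (Icc 0 s) w := by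
      have h := ((hder 1 (J : ℤ) w (hsub hw)).pow 2).const_mul (1 / 2 : ℝ)
      refine h.congr_deriv ?_
      rw [show (2 : ℕ) - 1 = 1 from rfl, pow_one]
      ring
    have h3 := (h1.sub h2).mono hsub
    refine (h3.congr_of_eventuallyEq ?_ ?_).congr_deriv (by ring)
    · exact Filter.Eventually.of_forall fun x => by simp [hΦ]
    · simp [hΦ]
  have hnn : ∀ w ∈ Icc u₁ u₂, 0 ≤ botSum ε₀ sideBranchTable X (J : ℤ) w +
      ∑ j ∈ Finset.range (J + 1), ∑ i : Fin 4,
        ν * (1 + ε₀) ^ ((2 : ℝ) * ((j : ℤ) : ℝ)) * X i (j : ℤ) w ^ 2 := by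
    intro w hw
    have hw' := hsub hw
    have hPi : 0 ≤ botSum ε₀ sideBranchTable X (J : ℤ) w := by
      rw [sideBranch_botSum]
      have h1 := hpos w hw' 0 ((J : ℤ) + 1) (by positivity)
      have h2 := hpos w hw' 2 ((J : ℤ) + 1) (by positivity)
      positivity
    have hD : 0 ≤ ∑ j ∈ Finset.range (J + 1), ∑ i : Fin 4,
        ν * (1 + ε₀) ^ ((2 : ℝ) * ((j : ℤ) : ℝ)) * X i (j : ℤ) w ^ 2 :=
      Finset.sum_nonneg fun j _ => Finset.sum_nonneg fun i _ =>
        mul_nonneg (mul_nonneg hν (Real.rpow_nonneg hb.le _)) (sq_nonneg _)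
    linarith
  have h := sideBranch_le_of_deriv_nonneg hderΦ hnn (right_mem_Icc.2 hu)
  simp only [hΦ] at h
  linarith

/-- **Modes just beyond the block are paid for by the escaped energy.** With the datum on shell `0`,
for `u ∈ [0,s]`, `m ∈ {1, 2}` and any component `i`:
`½X_{i,k+m}(u)² ≤ E₀ − B_k(u) ≤ E₀ − B_k(u) + ½s_k(u)²` (the block `0..k+2` started with `E₀` and
only lost energy). [this file] -/
theorem sideBranch_mode_sq_le_escaped (hε : 0 < ε₀) (hν : 0 ≤ ν)
    (hinit : ∀ (i : Fin 4) (k : ℤ), X i k 0 = if k = 0 then X₀ i else 0)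
    (hlow : ∀ (i : Fin 4) (k : ℤ), k < 0 → ∀ t : ℝ, X i k t = 0)
    (hder : ∀ (i : Fin 4) (k : ℤ), ∀ t ∈ Icc (0 : ℝ) s, HasDerivWithinAt (X i k)
      (quadTerm ε₀ sideBranchTable X i k t - ν * (1 + ε₀) ^ ((2 : ℝ) * k) * X i k t)
      (Icc (0 : ℝ) s) t)
    (hpos : ∀ t ∈ Icc (0 : ℝ) s, ∀ (i : Fin 4) (k : ℤ), 0 ≤ k → 0 ≤ X i k t)
    (k : ℕ) {u : ℝ} (hu : u ∈ Icc (0 : ℝ) s) (i : Fin 4) {m : ℕ} (hm1 : 1 ≤ m) (hm2 : m ≤ 2) :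
    (1 / 2 : ℝ) * X i ((k + m : ℕ) : ℤ) u ^ 2 ≤
      (∑ j : Fin 4, (1 / 2 : ℝ) * X₀ j ^ 2) -
        (∑ j ∈ Finset.range (k + 1), ∑ l : Fin 4, (1 / 2 : ℝ) * X l (j : ℤ) u ^ 2) +
        (1 / 2 : ℝ) * X 1 (k : ℤ) u ^ 2 := by
  -- the block `0..k+2` at time `0` holds `E₀`, at time `u` at most that
  have hanti := sideBranch_block_antitone hε hν hlow hder hpos (k + 2) le_rfl hu.1 hu.2
  have hB0 : (∑ j ∈ Finset.range (k + 2 + 1), ∑ l : Fin 4, (1 / 2 : ℝ) * X l (j : ℤ) 0 ^ 2) =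
      ∑ j : Fin 4, (1 / 2 : ℝ) * X₀ j ^ 2 := by
    rw [Finset.sum_range_succ']
    have h1 : ∀ j : ℕ, (∑ l : Fin 4, (1 / 2 : ℝ) * X l ((j + 1 : ℕ) : ℤ) 0 ^ 2) = 0 := fun j =>
      Finset.sum_eq_zero fun l _ => by
        rw [hinit, if_neg (by push_cast; omega)]
        ring
    simp only [h1, Finset.sum_const_zero, zero_add]
    refine Finset.sum_congr rfl fun l _ => ?_
    rw [hinit, if_pos (by simp)]
  rw [hB0] at hanti
  -- split the block `0..k+2` into `0..k` and the shells `k+1`, `k+2`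
  have hsplit : (∑ j ∈ Finset.range (k + 2 + 1), ∑ l : Fin 4, (1 / 2 : ℝ) * X l (j : ℤ) u ^ 2) =
      (∑ j ∈ Finset.range (k + 1), ∑ l : Fin 4, (1 / 2 : ℝ) * X l (j : ℤ) u ^ 2) +
        (∑ l : Fin 4, (1 / 2 : ℝ) * X l ((k + 1 : ℕ) : ℤ) u ^ 2) +
        ∑ l : Fin 4, (1 / 2 : ℝ) * X l ((k + 2 : ℕ) : ℤ) u ^ 2 := by
    rw [show k + 2 + 1 = (k + 1) + 1 + 1 by ring, Finset.sum_range_succ, Finset.sum_range_succ]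
  rw [hsplit] at hanti
  have hnn1 : ∀ n : ℕ, 0 ≤ ∑ l : Fin 4, (1 / 2 : ℝ) * X l (n : ℤ) u ^ 2 := fun n =>
    Finset.sum_nonneg fun l _ => by positivity
  have hsingle : ∀ n : ℕ, (1 / 2 : ℝ) * X i (n : ℤ) u ^ 2 ≤ ∑ l : Fin 4, (1 / 2 : ℝ) * X l (n : ℤ) u ^ 2 :=
    fun n => Finset.single_le_sum (f := fun l => (1 / 2 : ℝ) * X l (n : ℤ) u ^ 2)
      (fun l _ => by positivity) (Finset.mem_univ i)
  have hs2 : 0 ≤ (1 / 2 : ℝ) * X 1 (k : ℤ) u ^ 2 := by positivity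
  interval_cases m
  · have h1 := hsingle (k + 1)
    have h2 := hnn1 (k + 2)
    linarith
  · have h1 := hsingle (k + 2)
    have h2 := hnn1 (k + 1)
    linarith

/-- **The threshold step.** Along a regular solution of the `ν`-viscous `α_SB` lattice on `[0,s]`
(`ν > 0`) from the one-shell datum `X₀`, non-negative on the shells `≥ 0`, let `[t₀,t₁] ⊆ [0,s]` and
suppose on `[t₀,t₁]`: the driver is on, `Λ_k x_k² ≥ a ≥ 0`, and the escaped energy
`A_k = E₀ − B_k + ½s_k²` stays `≤ θ`. Then
`A_k(t₀) + a·(a/r)·((t₁ − t₀) − 1/r) ≤ A_k(t₁)`, `r = (6/5)Λ_{k+1}√(2θ) + ν_{k+1}`. [this file] -/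
theorem sideBranch_threshold_step (hε : 0 < ε₀) (hν : 0 < ν)
    (hinit : ∀ (i : Fin 4) (k : ℤ), X i k 0 = if k = 0 then X₀ i else 0)
    (hlow : ∀ (i : Fin 4) (k : ℤ), k < 0 → ∀ t : ℝ, X i k t = 0)
    (hder : ∀ (i : Fin 4) (k : ℤ), ∀ t ∈ Icc (0 : ℝ) s, HasDerivWithinAt (X i k)
      (quadTerm ε₀ sideBranchTable X i k t - ν * (1 + ε₀) ^ ((2 : ℝ) * k) * X i k t)
      (Icc (0 : ℝ) s) t)
    (hpos : ∀ t ∈ Icc (0 : ℝ) s, ∀ (i : Fin 4) (k : ℤ), 0 ≤ k → 0 ≤ X i k t)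
    (k : ℕ) {t₀ t₁ a θ : ℝ} (ht₀ : 0 ≤ t₀) (ht : t₀ ≤ t₁) (ht₁ : t₁ ≤ s) (ha : 0 ≤ a)
    (hx : ∀ u ∈ Icc t₀ t₁, a ≤ (1 + ε₀) ^ ((5 : ℝ) * ((k : ℤ) : ℝ) / 2) * X 0 (k : ℤ) u ^ 2)
    (hA : ∀ u ∈ Icc t₀ t₁,
      (∑ j : Fin 4, (1 / 2 : ℝ) * X₀ j ^ 2) -
          (∑ j ∈ Finset.range (k + 1), ∑ l : Fin 4, (1 / 2 : ℝ) * X l (j : ℤ) u ^ 2) +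
        (1 / 2 : ℝ) * X 1 (k : ℤ) u ^ 2 ≤ θ) :
    ((∑ j : Fin 4, (1 / 2 : ℝ) * X₀ j ^ 2) -
          (∑ j ∈ Finset.range (k + 1), ∑ l : Fin 4, (1 / 2 : ℝ) * X l (j : ℤ) t₀ ^ 2) +
        (1 / 2 : ℝ) * X 1 (k : ℤ) t₀ ^ 2) +
      a * (a / ((6 / 5 : ℝ) * (1 + ε₀) ^ ((5 : ℝ) * (((k : ℤ) + 1 : ℤ) : ℝ) / 2) * Real.sqrt (2 * θ) +
          ν * (1 + ε₀) ^ ((2 : ℝ) * (((k : ℤ) + 1 : ℤ) : ℝ)))) *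
        ((t₁ - t₀) - 1 / ((6 / 5 : ℝ) * (1 + ε₀) ^ ((5 : ℝ) * (((k : ℤ) + 1 : ℤ) : ℝ) / 2) *
          Real.sqrt (2 * θ) + ν * (1 + ε₀) ^ ((2 : ℝ) * (((k : ℤ) + 1 : ℤ) : ℝ)))) ≤
      (∑ j : Fin 4, (1 / 2 : ℝ) * X₀ j ^ 2) -
          (∑ j ∈ Finset.range (k + 1), ∑ l : Fin 4, (1 / 2 : ℝ) * X l (j : ℤ) t₁ ^ 2) +
        (1 / 2 : ℝ) * X 1 (k : ℤ) t₁ ^ 2 := by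
  have hsub : Icc t₀ t₁ ⊆ Icc (0 : ℝ) s := Icc_subset_Icc ht₀ ht₁
  set ρ : ℝ := Real.sqrt (2 * θ) with hρdef
  have hρ : 0 ≤ ρ := Real.sqrt_nonneg _
  -- drains of `x_{k+1}` are small: paid for by the escaped energy `≤ θ`
  have hmode : ∀ u ∈ Icc t₀ t₁, ∀ (i : Fin 4) {m : ℕ}, 1 ≤ m → m ≤ 2 →
      X i ((k + m : ℕ) : ℤ) u ≤ ρ := by
    intro u hu i m hm1 hm2
    have h1 := sideBranch_mode_sq_le_escaped hε hν.le hinit hlow hder hpos k (hsub hu) i hm1 hm2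
    have h2 : X i ((k + m : ℕ) : ℤ) u ^ 2 ≤ 2 * θ := by linarith [hA u hu]
    calc X i ((k + m : ℕ) : ℤ) u ≤ |X i ((k + m : ℕ) : ℤ) u| := le_abs_self _
      _ = Real.sqrt (X i ((k + m : ℕ) : ℤ) u ^ 2) := (Real.sqrt_sq_eq_abs _).symm
      _ ≤ ρ := Real.sqrt_le_sqrt h2
  have hc1 : (((k + 1 : ℕ) : ℤ)) = (k : ℤ) + 1 := by push_cast; ring
  have hc2 : (((k + 2 : ℕ) : ℤ)) = (k : ℤ) + 1 + 1 := by push_cast; ring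
  have hx2 : ∀ u ∈ Icc t₀ t₁, X 0 ((k : ℤ) + 1 + 1) u ≤ ρ := fun u hu => by
    rw [← hc2]; exact hmode u hu 0 (by norm_num) le_rfl
  have hs1 : ∀ u ∈ Icc t₀ t₁, X 1 ((k : ℤ) + 1) u ≤ ρ := fun u hu => by
    rw [← hc1]; exact hmode u hu 1 le_rfl (by norm_num)
  have hy0 : ∀ u ∈ Icc t₀ t₁, 0 ≤ X 0 ((k : ℤ) + 1) u := fun u hu =>
    hpos u (hsub hu) 0 _ (by positivity)
  have hsk : ∀ u ∈ Icc t₀ t₁, 0 ≤ X 1 (k : ℤ) u := fun u hu => hpos u (hsub hu) 1 _ (by positivity)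
  have hgain := sideBranch_liveBlock_gain hε hν hlow hder k ht₀ ht ht₁ ha hρ hx hy0 hsk hx2 hs1
  linarith

end Solution

end Summit.NavierStokesRegularity.NavierStokesRegularity.Theorems.SubOnsagerCeiling

end
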